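import Mathlib
import Summits.ValiantsHypothesis.ValiantsHypothesis.Theorems.LiouvilleSarnakAlignedTypeICharactersMod2nAssembly
import Summits.ValiantsHypothesis.ValiantsHypothesis.Theorems.LiouvilleSarnakAlignedTypeICharactersMod2nKMTVariance
import Summits.ValiantsHypothesis.ValiantsHypothesis.Theorems.LiouvilleSarnakAlignedTypeICharactersMod2nTwistedLiouvilleOfBS
import HarnessLib

/-!
# Route LiouvilleSarnak — support `AlignedTypeI` (stmt-ValiantsHypothesis-21040), line `characters_mod_2n`:
# the crux conditional on the two named Literature facts

The registered line `Cruxes/AlignedTypeI/Lines/characters_mod_2n.lean` composes three stubs: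
`stub_assembly : KMTVariance → TwistedLiouvilleSmall → AlignedTypeI` (landed, p583826),
`stub_kmtVariance : KMTVariance` and `stub_twistedLiouvilleSmall : TwistedLiouvilleSmall`.  The tree now proves the
last two CONDITIONALLY, each on exactly one named Literature fact (published theorems, NOT proved in the tree):

* `kmtVariance_of_KMT13 : KMT2023_theorem13_liouville_twoPower → KMTVariance` (Klurman–Mangerel–Teräväinen, Proc. LMS
  127 (2023), Thm 1.3, for `f = λ`, `q = Q = 2^k`; file `…CharactersMod2nKMTVariance.lean`);
* `twistedLiouvilleSmall_of_BS : BanksShparlinski2019_theorem22_twoPower → TwistedLiouvilleSmall` (Banks–Shparlinski,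
  Trans. AMS 373, Thm 2.2, for `q = 2^γ`; file `…CharactersMod2nTwistedLiouvilleOfBS.lean`).

This file records the composition: the route statement `AlignedTypeI` BY NAME, conditional on the two facts
(`alignedTypeI_of_KMT13_of_BS22`).  It is a `conditional-result`: the item stmt-ValiantsHypothesis-21040 is NOT closed
(neither fact has a `_holds`; both are of Matomäki–Radziwiłł / zero-free-region depth); the milestone
`DigitalBilinearLiouville` is untouched; nothing here bears on `VP ≠ VNP` (NOT proved).
-/

set_option linter.dupNamespace false

namespace Summit.ValiantsHypothesis.ValiantsHypothesis.Theorems.LiouvilleSarnak.AlignedTypeI.CharactersModTwoN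

/-- **`AlignedTypeI` conditional on Klurman–Mangerel–Teräväinen 2023 Thm 1.3 and Banks–Shparlinski 2019 Thm 2.2**
(both for `2`-power moduli, as named Literature facts): `Σ_{a<2^n} |Σ_{b<2^n} λ(a + 2^n b + 1)| ≤ ε 4^n` for all large
`n`.  Composition of the landed `stub_assembly` with `kmtVariance_of_KMT13` and `twistedLiouvilleSmall_of_BS`.
[cite: KlurmanMangerelTeravainen2023ShortAPs, Theorem 1.3; BanksShparlinski2019PowerfulModuli, Theorem 2.2] -/
theorem alignedTypeI_of_KMT13_of_BS22
    (hKMT : Literature.NumberTheory.LFunctions.KMT2023_theorem13_liouville_twoPower)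
    (hBS : Literature.NumberTheory.LFunctions.BanksShparlinski2019_theorem22_twoPower) :
    Summit.ValiantsHypothesis.ValiantsHypothesis.Theses.LiouvilleSarnak.AlignedTypeI :=
  stub_assembly (kmtVariance_of_KMT13 hKMT) (twistedLiouvilleSmall_of_BS hBS)

end Summit.ValiantsHypothesis.ValiantsHypothesis.Theorems.LiouvilleSarnak.AlignedTypeI.CharactersModTwoN
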